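import Summits.MatrixMultiplication.OmegaCensus.StrongUSPCheck
import Literature.Computability.QuantumComplexity.PermanentSearchRandom
import Mathlib.Data.Finset.Card
import HarnessLib

/-!
# ω-census, family (b′): bit-packed strong-USP certificates, part 1 — the silent-triple hypergraph as ONE natural number

HONEST FRAMING (pub-omega census; verbatim): lottery ticket; floor = certified bounds/negative ranges.
Census bookkeeping, not progress on `ω`.

Plumbing for the bit-packed SIMPLIFICATION-CERTIFICATE checker of `StrongUSPCertPacked.lean` (pigeonhole certificate steps on
the hypergraph of silent row triples = the edge deletions of Anderson–Le's `Simplify`, arXiv:2307.06463 §3): the hypergraph of a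
puzzle with `s` rows is ONE natural number (bit `w + (v + u·s)·s` ⇔ triple `(u,v,w)` alive), the rows are packed into three
natural numbers (`scbPack row q`, `k`-bit fields "column `i` of row `u` carries symbol `q`"), and silence of a triple is a few
big-integer operations (`scbSilentFast`), so that the kernel evaluates everything with GMP arithmetic and `decide +kernel` stays
within its memory budget for Anderson–Le's `(23,7)` and `(35,8)` puzzles (the list-based checker `StrongUSPSimplCert.lean` reaches
`(14,6)`).  Main lemma here: `testBit_scbInit` — bit `scbIdx s u v w` of the initial number is `uspSilent row u v w`.
-/

namespace Summit.MatrixMultiplication.OmegaCensus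

open Literature.Computability.AlgebraicComplexity Equiv
open Literature.Computability.QuantumComplexity.PerSearch (radix_inj)

variable {s k : ℕ}

/-! ## Bit-set plumbing -/

/-- Bit index of the triple `(u,v,w)` for side length `B`: `w + (v + u·B)·B`. [folklore] -/
def scbIdx (B u v w : ℕ) : ℕ := w + (v + u * B) * B

/-- `⋁_{a ∈ l} f a` as a natural-number bit set. [folklore] -/
def scbOr (l : List ℕ) (f : ℕ → ℕ) : ℕ := l.foldr (fun a acc => f a ||| acc) 0

/-- Bits `j` of `scbOr l f` are the bits set in some `f a`, `a ∈ l`. [folklore] -/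
theorem testBit_scbOr (l : List ℕ) (f : ℕ → ℕ) (j : ℕ) :
    (scbOr l f).testBit j = true ↔ ∃ a ∈ l, (f a).testBit j = true := by
  induction l with
  | nil => simp [scbOr]
  | cons a l ih =>
      simp only [scbOr, List.foldr_cons, Nat.testBit_or, Bool.or_eq_true, List.mem_cons, exists_eq_or_imp]
      rw [← ih]; rfl

/-- The `n`-bit window of `H` starting at bit `a`. [folklore] -/
def scbWin (H a n : ℕ) : ℕ := (H >>> a) &&& (2 ^ n - 1)

/-- Bits of a window. [folklore] -/
theorem testBit_scbWin (H a n j : ℕ) : (scbWin H a n).testBit j = (decide (j < n) && H.testBit (a + j)) := by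
  simp [scbWin]

/-- The bit set `{g z : z < B}`. [folklore] -/
def scbMask (B : ℕ) (g : ℕ → ℕ) : ℕ := scbOr (List.range B) fun z => 2 ^ g z

/-- Bits of `scbMask`. [folklore] -/
theorem testBit_scbMask (B : ℕ) (g : ℕ → ℕ) (i : ℕ) :
    (scbMask B g).testBit i = true ↔ ∃ z < B, g z = i := by
  rw [scbMask, testBit_scbOr]
  simp [Nat.testBit_two_pow, List.mem_range]

/-- Base-`B` digits are unique: `scbIdx` is injective on triples with `v, w < B` (and any `u`). [folklore] -/
theorem scbIdx_inj {B u v w u' v' w' : ℕ} (hv : v < B) (hw : w < B) (hv' : v' < B) (hw' : w' < B)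
    (h : scbIdx B u v w = scbIdx B u' v' w') : u = u' ∧ v = v' ∧ w = w' := by
  have hB : 0 < B := by omega
  unfold scbIdx at h
  have hmod := congrArg (· % B) h
  have hdiv := congrArg (· / B) h
  simp only [Nat.add_mul_mod_self_right, Nat.mod_eq_of_lt hw, Nat.mod_eq_of_lt hw'] at hmod
  simp only [Nat.add_mul_div_right _ _ hB, Nat.div_eq_of_lt hw, Nat.div_eq_of_lt hw', Nat.zero_add] at hdiv
  have hmod2 := congrArg (· % B) hdiv
  have hdiv2 := congrArg (· / B) hdiv
  simp only [Nat.add_mul_mod_self_right, Nat.mod_eq_of_lt hv, Nat.mod_eq_of_lt hv'] at hmod2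
  simp only [Nat.add_mul_div_right _ _ hB, Nat.div_eq_of_lt hv, Nat.div_eq_of_lt hv', Nat.zero_add] at hdiv2
  exact ⟨hdiv2, hmod2, hmod⟩

/-- `scbIdx B u v w < B³` for digits `< B`. [folklore] -/
theorem scbIdx_lt {B u v w : ℕ} (hu : u < B) (hv : v < B) (hw : w < B) : scbIdx B u v w < B * B * B := by
  unfold scbIdx
  have h1 : v + u * B < B * B := by nlinarith
  nlinarith

/-! ## The silent-triple bit set (rows packed into three natural numbers, so that silence is a few GMP operations) -/

/-- Column bit set of row `u` for symbol `q`: bit `i` set iff `row u i = q`. [folklore] -/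
def scbCol (row : Fin s → Fin k → Fin 3) (q : Fin 3) (u : ℕ) : ℕ :=
  scbOr (List.range k) fun i => if h : u < s ∧ i < k then (if row ⟨u, h.1⟩ ⟨i, h.2⟩ = q then 2 ^ i else 0) else 0

/-- Bits of `scbCol`. [folklore] -/
theorem testBit_scbCol (row : Fin s → Fin k → Fin 3) (q : Fin 3) (u : Fin s) (i : Fin k) :
    (scbCol row q u.val).testBit i.val = decide (row u i = q) := by
  apply Bool.eq_iff_iff.2
  rw [scbCol, testBit_scbOr, decide_eq_true_eq]
  constructor
  · rintro ⟨j, hj, h⟩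
    rw [List.mem_range] at hj
    rw [dif_pos ⟨u.isLt, hj⟩] at h
    by_cases hq : row ⟨u.val, u.isLt⟩ ⟨j, hj⟩ = q
    · rw [if_pos hq, Nat.testBit_two_pow, decide_eq_true_eq] at h
      have : (⟨j, hj⟩ : Fin k) = i := Fin.ext h
      rw [← this]; exact hq
    · rw [if_neg hq] at h; simp at h
  · intro hq
    refine ⟨i.val, List.mem_range.2 i.isLt, ?_⟩
    rw [dif_pos ⟨u.isLt, i.isLt⟩, if_pos hq, Nat.testBit_two_pow]
    simp

/-- A set bit of `scbCol` is a column index. [folklore] -/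
theorem lt_of_testBit_scbCol {row : Fin s → Fin k → Fin 3} {q : Fin 3} {u j : ℕ}
    (h : (scbCol row q u).testBit j = true) : j < k := by
  rw [scbCol, testBit_scbOr] at h
  obtain ⟨i, hi, h⟩ := h
  rw [List.mem_range] at hi
  by_cases hc : u < s ∧ i < k
  · rw [dif_pos hc] at h
    split at h
    · rw [Nat.testBit_two_pow, decide_eq_true_eq] at h; omega
    · simp at h
  · rw [dif_neg hc] at h; simp at h

/-- All rows' column bit sets for symbol `q`, packed in `k`-bit fields: field `u` = `scbCol row q u`. [folklore] -/
def scbPack (row : Fin s → Fin k → Fin 3) (q : Fin 3) : ℕ :=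
  scbOr (List.range s) fun u => scbCol row q u <<< (u * k)

/-- Field extraction from `scbPack`. [folklore] -/
theorem testBit_scbPack (row : Fin s → Fin k → Fin 3) (q : Fin 3) (u : Fin s) (i : Fin k) :
    (scbPack row q).testBit (u.val * k + i.val) = (scbCol row q u.val).testBit i.val := by
  apply Bool.eq_iff_iff.2
  rw [scbPack, testBit_scbOr]
  constructor
  · rintro ⟨u', -, h⟩
    rw [Nat.testBit_shiftLeft, Bool.and_eq_true, decide_eq_true_eq] at h
    obtain ⟨hge, h⟩ := h
    have hj := lt_of_testBit_scbCol h
    have heq : u' * k + (u.val * k + i.val - u' * k) = u.val * k + i.val := by omega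
    obtain ⟨h1, h2⟩ := radix_inj (W := k) hj i.isLt heq
    subst h1
    rw [h2] at h; exact h
  · intro h
    refine ⟨u.val, List.mem_range.2 u.isLt, ?_⟩
    rw [Nat.testBit_shiftLeft, Bool.and_eq_true, decide_eq_true_eq]
    exact ⟨by omega, by simpa using h⟩

/-- Silence of the triple `(a,b,c)` from the packed rows: with `A, B, C` the column sets "`row a = 1`", "`row b = 2`",
"`row c = 3`" (symbols coded `0,1,2`), NO column has exactly two of them iff `(A∧B)∨(A∧C)∨(B∧C) = A∧B∧C`.
[cite: CohnKleinbergSzegedyUmans2005, §3 (p. 5)] -/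
def scbSilentFast (P0 P1 P2 kk a b c : ℕ) : Bool :=
  ((scbWin P0 (a * kk) kk &&& scbWin P1 (b * kk) kk) ||| (scbWin P0 (a * kk) kk &&& scbWin P2 (c * kk) kk) |||
      (scbWin P1 (b * kk) kk &&& scbWin P2 (c * kk) kk)) ==
    (scbWin P0 (a * kk) kk &&& scbWin P1 (b * kk) kk &&& scbWin P2 (c * kk) kk)

/-- `scbSilentFast` on the packed rows is `uspSilent`. [cite: CohnKleinbergSzegedyUmans2005, §3 (p. 5)] -/
theorem scbSilentFast_eq (row : Fin s → Fin k → Fin 3) (a b c : Fin s) :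
    scbSilentFast (scbPack row 0) (scbPack row 1) (scbPack row 2) k a.val b.val c.val = uspSilent row a b c := by
  -- bit `j` of the three windows
  have hw : ∀ (q : Fin 3) (u : Fin s) (j : ℕ),
      (scbWin (scbPack row q) (u.val * k) k).testBit j = (decide (j < k) && (scbCol row q u.val).testBit j) := by
    intro q u j
    rw [testBit_scbWin]
    by_cases hj : j < k
    · rw [testBit_scbPack row q u ⟨j, hj⟩]
    · simp [hj]
  apply Bool.eq_iff_iff.2
  simp only [scbSilentFast, beq_iff_eq, uspSilent, decide_eq_true_eq]
  constructor
  · intro h i hx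
    have hb := congrArg (fun n => n.testBit i.val) h
    simp only [Nat.testBit_or, Nat.testBit_and, hw, i.isLt, decide_true, Bool.true_and, testBit_scbCol] at hb
    rcases hx with ⟨h0, h1, h2⟩ | ⟨h0, h1, h2⟩ | ⟨h0, h1, h2⟩ <;> simp [h0, h1, h2] at hb
  · intro h
    apply Nat.eq_of_testBit_eq
    intro j
    simp only [Nat.testBit_or, Nat.testBit_and, hw]
    by_cases hj : j < k
    · have hx := h ⟨j, hj⟩
      simp only [hj, decide_true, Bool.true_and, testBit_scbCol _ _ _ ⟨j, hj⟩]
      simp only [USPExactlyTwo, not_or, not_and] at hx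
      obtain ⟨hx1, hx2, hx3⟩ := hx
      by_cases h0 : row a ⟨j, hj⟩ = 0 <;> by_cases h1 : row b ⟨j, hj⟩ = 1 <;> by_cases h2 : row c ⟨j, hj⟩ = 2 <;>
        simp_all
    · simp [hj]

/-- The initial hypergraph as ONE natural number: bit `scbIdx B u v w` set iff `(u,v,w)` is a silent triple
(three nested `B`-fold unions; silence read off the packed rows). [cite: AndersonJiXu2020, §3.1 (3D-matching formulation)] -/
def scbInit (P0 P1 P2 B kk : ℕ) : ℕ :=
  scbOr (List.range B) fun a => scbOr (List.range B) fun b => scbOr (List.range B) fun c =>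
    if scbSilentFast P0 P1 P2 kk a b c then 2 ^ scbIdx B a b c else 0

/-- Membership of a triple in the initial bit set is its silence. [folklore] -/
theorem testBit_scbInit (row : Fin s → Fin k → Fin 3) (u v w : Fin s) :
    (scbInit (scbPack row 0) (scbPack row 1) (scbPack row 2) s k).testBit (scbIdx s u.val v.val w.val) =
      uspSilent row u v w := by
  apply Bool.eq_iff_iff.2
  rw [scbInit, testBit_scbOr]
  constructor
  · rintro ⟨a, ha, h⟩
    rw [testBit_scbOr] at h
    obtain ⟨b, hb, h⟩ := h
    rw [testBit_scbOr] at h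
    obtain ⟨c, hc, h⟩ := h
    rw [List.mem_range] at ha hb hc
    by_cases hs : scbSilentFast (scbPack row 0) (scbPack row 1) (scbPack row 2) k a b c = true
    · rw [hs, if_pos rfl, Nat.testBit_two_pow, decide_eq_true_eq] at h
      obtain ⟨h1, h2, h3⟩ := scbIdx_inj hb hc v.isLt w.isLt h
      subst h1; subst h2; subst h3
      rw [← scbSilentFast_eq]; exact hs
    · rw [Bool.not_eq_true] at hs
      rw [hs] at h
      simp at h
  · intro hsil
    refine ⟨u.val, List.mem_range.2 u.isLt, ?_⟩
    rw [testBit_scbOr]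
    refine ⟨v.val, List.mem_range.2 v.isLt, ?_⟩
    rw [testBit_scbOr]
    refine ⟨w.val, List.mem_range.2 w.isLt, ?_⟩
    have hs : scbSilentFast (scbPack row 0) (scbPack row 1) (scbPack row 2) k u.val v.val w.val = true := by
      rw [scbSilentFast_eq]; exact hsil
    rw [hs, if_pos rfl, Nat.testBit_two_pow, decide_eq_true_eq]

end Summit.MatrixMultiplication.OmegaCensus
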